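import Literature.AlgebraicGeometry.Resolution.KollarOrderReduction
import Literature.AlgebraicGeometry.Resolution.CanonicalResolutionSmoothCentre
import Literature.AlgebraicGeometry.Resolution.BlowupsExistence
import Literature.AlgebraicGeometry.Resolution.LargeCharacteristic
import Mathlib.RingTheory.MvPolynomial.Basic
import Mathlib.RingTheory.Localization.FractionRing
import Mathlib.Algebra.CharP.Algebra
import HarnessLib

/-!
# BGMW Cor. 8.0.6 from characteristic zero: the reduction to a spreading-out step

Topic: `Literature/AlgebraicGeometry/Resolution`. The LARGE-CHARACTERISTIC MARKED-RESOLUTION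
STATEMENT — a resolution of the marked ideal `(𝔸ⁿ_k, (S), ∅, 1)` exists for `k` perfect of
characteristic `p > M(d, n, l)`, `|S| ≤ l`, degrees `≤ d` (Bierstone–Grigoriev–Milman–Włodarczyk
2011, Thm. 8.0.5 existence clause / Cor. 8.0.7; it is the explicit hypothesis of
`bierstoneGrigorievMilmanWlodarczyk2011_of_marked`, `EffectiveResolutionMarked.lean`, which turns
it into Cor. 8.0.6 = the named fact `BierstoneGrigorievMilmanWlodarczyk2011`; it is NOT itself a
named fact of the tree) — is PROVED here, with a NON-explicit bound `M`, from two inputs: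

* (C0) resolution of the marked ideals `(𝔸ⁿ_K, (S), ∅, 1)` over every field `K` of
  characteristic ZERO — `∀ K [CharZero K] n S, HasMarkedResolution K n S`, written OUT as a
  hypothesis wherever it is used (it is NOT a declaration of the tree: as a statement it is the
  special case `X = 𝔸ⁿ_K`, `m = 1`, `E = ∅` of the tree's named fact
  `Kollar2007MarkedOrderReduction`, `KollarOrderReduction.lean`; Kollár 2007, Thm. 3.69, order
  reduction for marked ideals — the single fact on which `Hironaka1964` rests — and it is PROVED
  from that fact here: `charZeroMarkedResolution_of_kollar`, the case `(S) = 0`, excluded by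
  Kollár, being the one-step resolution by blowing up the whole space, BGMW Thm. 4.0.6 proof,
  first line; D-0026 review 2026-08-15: the former pass-through definition naming (C0) was
  merged back into this implication);
* (SP) `SpreadsFromGenericPoint n d l` — the SPREADING-OUT STEP (a `Prop`, NOT a named fact and
  NOT yet proved; classical technique of EGA IV₃ §8 / IV₄ §17): if the universal instance over the
  fraction field of `ℤ[c]/𝔮` (`ℤ[c]` the ring of universal coefficients, `𝔮` a prime of residue
  characteristic zero) has a resolution, then so does every instance at a field-valued point of a
  neighbourhood `D(f) ∩ V(𝔮)`;

via the Noetherian induction of `LargeCharacteristic.lean`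
(`exists_bound_forall_prime_of_generic`): **`marked_of_charZero_of_spreads`** and
**`marked_of_kollar_of_spreads : Kollar2007MarkedOrderReduction.{0} → (∀ n d l,
SpreadsFromGenericPoint n d l) → ∃ M, ∀ p prime, ∀ k perfect of characteristic p, ∀ n d l S,
|S| ≤ l → deg ≤ d → M d n l < p → HasMarkedResolution k n S`**, PROVED. In fact the argument
gives all fields of characteristic `p > M`, not only perfect ones (the quantifier prefix is kept
identical to that of `BierstoneGrigorievMilmanWlodarczyk2011`). What this buys:
the positive-characteristic algorithm of BGMW §8 together with its multiplicity bound `M(d, n, l)`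
(Lemma 8.0.3, the §§5–7 complexity recursion) is replaced by the characteristic-zero theorem
(shared with `Hironaka1964`) plus spreading out; the remaining work on this line is
`SpreadsFromGenericPoint`.

## Content

* `HasMarkedResolution k n S` — the instance statement (`∃` resolution of `(𝔸ⁿ_k, (S), ∅, 1)`);
  `hasMarkedResolution_congr` — it only depends on the ideal `(S)`;
* `CoeffRing n d l = ℤ[c_{j,e}]`, `univPoly`, `univFamily φ` — the universal family of `l`
  polynomials in `n` variables with all exponents `≤ d`, specialized along `φ : ℤ[c] → A`;
  `span_univFamily_coeffHom` — every `S` with `|S| ≤ l`, `deg ≤ d` is, up to the ideal it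
  generates, a specialization;
* `charZeroMarkedResolution_of_kollar` — (C0) from `Kollar2007MarkedOrderReduction` (PROVED);
  `SpreadsFromGenericPoint` (Prop, open; bypassed by `EffectiveResolutionCharZeroReduction.lean`);
* `marked_of_charZero_of_spreads`, `marked_of_kollar_of_spreads` — PROVED.

## Sources

* E. Bierstone, D. Grigoriev, P. Milman, J. Włodarczyk, arXiv:1206.3090, Thm. 4.0.6, §8
  (Lemma 8.0.3, Thm. 8.0.5, Remark, Cor. 8.0.6–7) (numbering as in `EffectiveResolution.lean` and
  `EffectiveResolutionMarked.lean`). [BierstoneGrigorievMilmanWlodarczyk2011]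
* J. Kollár, *Lectures on Resolution of Singularities* (2007), Def. 3.66, Thm. 3.69 (p. 150).
  [Kollar2007]
-/

noncomputable section

open CategoryTheory AlgebraicGeometry MvPolynomial

namespace Literature.AlgebraicGeometry.Resolution

/-! ## The instance statement and its invariance under change of generators -/

/-- **`(𝔸ⁿ_k, (S), ∅, 1)` has a resolution** (in the sense of `MarkedIdeals.lean`,
`IsMarkedResolution`): the instance of BGMW Thm. 8.0.5 / Kollár Thm. 3.69 quantified in
(C0) (`charZeroMarkedResolution_of_kollar`) / `SpreadsFromGenericPoint` below and in the
hypothesis of `bierstoneGrigorievMilmanWlodarczyk2011_of_marked` (`EffectiveResolutionMarked.lean`).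
[folklore] -/
def HasMarkedResolution (k : Type) [Field k] (n : ℕ) (S : Finset (MvPolynomial (Fin n) k)) : Prop :=
  ∃ (X' : Scheme.{0}) (σ : X' ⟶ Spec (CommRingCat.of (MvPolynomial (Fin n) k))) (M' : MarkedIdeal X'),
    IsMarkedResolution ⟨(affineZeroLocusι k n S).ker, [], 1⟩ σ M'

/-- The ideal sheaf of `V(S) ↪ 𝔸ⁿ_k` only depends on the ideal `(S)`. [folklore] -/
theorem ker_affineZeroLocusι_eq_of_span_eq (k : Type) [Field k] (n : ℕ)
    {S S' : Finset (MvPolynomial (Fin n) k)}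
    (h : Ideal.span (S : Set (MvPolynomial (Fin n) k)) = Ideal.span (S' : Set _)) :
    (affineZeroLocusι k n S).ker = (affineZeroLocusι k n S').ker := by
  delta affineZeroLocusι affineZeroLocus
  let e : (MvPolynomial (Fin n) k ⧸ Ideal.span (S : Set (MvPolynomial (Fin n) k))) ≃+*
      (MvPolynomial (Fin n) k ⧸ Ideal.span (S' : Set (MvPolynomial (Fin n) k))) :=
    Ideal.quotEquivOfEq h
  have hfac : CommRingCat.ofHom (Ideal.Quotient.mk (Ideal.span (S' : Set (MvPolynomial (Fin n) k)))) =
      CommRingCat.ofHom (Ideal.Quotient.mk (Ideal.span (S : Set (MvPolynomial (Fin n) k)))) ≫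
        e.toCommRingCatIso.hom := by
    change _ = CommRingCat.ofHom _ ≫ CommRingCat.ofHom e.toRingHom
    rw [← CommRingCat.ofHom_comp]
    congr 1
  rw [hfac, Spec.map_comp, Scheme.Hom.ker_comp_of_isIso]

/-- `HasMarkedResolution` only depends on the ideal `(S)`. [folklore] -/
theorem hasMarkedResolution_congr (k : Type) [Field k] (n : ℕ)
    {S S' : Finset (MvPolynomial (Fin n) k)}
    (h : Ideal.span (S : Set (MvPolynomial (Fin n) k)) = Ideal.span (S' : Set _)) :
    HasMarkedResolution k n S ↔ HasMarkedResolution k n S' := by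
  unfold HasMarkedResolution
  rw [ker_affineZeroLocusι_eq_of_span_eq k n h]

/-! ## The universal family of `l` polynomials with exponents `≤ d` in `n` variables -/

/-- Indices of the universal coefficients: `(j, e)` with `j < l` and `e` an exponent vector with
entries `≤ d`. [folklore] -/
abbrev CoeffIdx (n d l : ℕ) : Type := Fin l × (Fin n → Fin (d + 1))

/-- **The ring of universal coefficients `ℤ[c_{j,e}]`** of `l` polynomials in `n` variables all
of whose exponents are `≤ d` (a Noetherian ring; its prime spectrum parametrizes the inputs of
BGMW Cor. 8.0.6 up to the ideal they generate). [folklore] -/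
abbrev CoeffRing (n d l : ℕ) : Type := MvPolynomial (CoeffIdx n d l) ℤ

/-- The exponent vector (a finitely supported function) of `e : Fin n → Fin (d+1)`. [folklore] -/
def expVec {n d : ℕ} (e : Fin n → Fin (d + 1)) : Fin n →₀ ℕ :=
  Finsupp.equivFunOnFinite.symm fun i => (e i : ℕ)

/-- Unfolding `expVec`. [folklore] -/
@[simp] theorem expVec_apply {n d : ℕ} (e : Fin n → Fin (d + 1)) (i : Fin n) :
    expVec e i = (e i : ℕ) := rfl

/-- `expVec` is injective. [folklore] -/
theorem expVec_injective (n d : ℕ) : Function.Injective (expVec (n := n) (d := d)) := by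
  intro e e' h
  funext i
  exact Fin.ext (by simpa using congrArg (fun v => v i) h)

/-- **The universal polynomials** `F_j = Σ_e c_{j,e} X^e`, specialized along `φ : ℤ[c] → A`.
[folklore] -/
def univPoly (n d l : ℕ) {A : Type} [CommRing A] (φ : CoeffRing n d l →+* A) (j : Fin l) :
    MvPolynomial (Fin n) A :=
  ∑ e : Fin n → Fin (d + 1), monomial (expVec e) (φ (X (j, e)))

/-- The specialized universal family as a finite set of polynomials. [folklore] -/
def univFamily (n d l : ℕ) {A : Type} [CommRing A] (φ : CoeffRing n d l →+* A) :
    Finset (MvPolynomial (Fin n) A) := by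
  classical
  exact Finset.univ.image (univPoly n d l φ)

/-! ## Every input is a specialization of the universal family -/

section Specialize

variable {k : Type} [Field k] {n d l : ℕ} (S : Finset (MvPolynomial (Fin n) k))

/-- The coefficient assignment of an enumerated input `S = {s₀, …, s_{m-1}}`, `m = |S| ≤ l`:
`c_{j,e} ↦ coeff_{X^e}(s_j)` for `j < m`, and `0` for `j ≥ m`. [folklore] -/
def coeffFun (j : Fin l) (e : Fin n → Fin (d + 1)) : k :=
  if h : (j : ℕ) < S.card then coeff (expVec e) ((S.equivFin.symm ⟨j, h⟩ : S) : MvPolynomial (Fin n) k)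
  else 0

/-- The specialization `ℤ[c] → k` at the input `S`. [folklore] -/
def coeffHom : CoeffRing n d l →+* k :=
  eval₂Hom (Int.castRingHom k) fun je => coeffFun S je.1 je.2

/-- `coeffHom` on the coefficient variables. [folklore] -/
@[simp] theorem coeffHom_X (j : Fin l) (e : Fin n → Fin (d + 1)) :
    coeffHom S (X (j, e) : CoeffRing n d l) = coeffFun S j e := by
  simp [coeffHom]

/-- A polynomial of total degree `≤ d` is the sum of its terms over all exponent vectors with
entries `≤ d`. [folklore] -/
theorem sum_monomial_expVec_coeff {s : MvPolynomial (Fin n) k} (hs : s.totalDegree ≤ d) :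
    ∑ e : Fin n → Fin (d + 1), monomial (expVec e) (coeff (expVec e) s) = s := by
  classical
  rw [← Finset.sum_image (f := fun v => monomial v (coeff v s))
    (fun e _ e' _ h => expVec_injective n d h)]
  conv_rhs => rw [as_sum s]
  symm
  apply Finset.sum_subset
  · intro v hv
    rw [Finset.mem_image]
    have hvi : ∀ i, v i ≤ d := fun i =>
      ((Finsupp.le_degree i v).trans (le_totalDegree hv)).trans hs
    exact ⟨fun i => ⟨v i, Nat.lt_succ_of_le (hvi i)⟩, Finset.mem_univ _, by ext i; rfl⟩
  · intro v _ hv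
    rw [notMem_support_iff.mp hv, monomial_zero]

/-- The universal polynomial `F_j` specializes at `S` to `s_j` (`j < |S|`). [folklore] -/
theorem univPoly_coeffHom_of_lt (hd : ∀ f ∈ S, f.totalDegree ≤ d) (j : Fin l) (hj : (j : ℕ) < S.card) :
    univPoly n d l (coeffHom S) j = ((S.equivFin.symm ⟨j, hj⟩ : S) : MvPolynomial (Fin n) k) := by
  unfold univPoly
  simp only [coeffHom_X, coeffFun, dif_pos hj]
  exact sum_monomial_expVec_coeff (hd _ (S.equivFin.symm ⟨j, hj⟩).2)

/-- … and to `0` for `j ≥ |S|`. [folklore] -/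
theorem univPoly_coeffHom_of_le (j : Fin l) (hj : S.card ≤ (j : ℕ)) :
    univPoly n d l (coeffHom S) j = 0 := by
  unfold univPoly
  simp only [coeffHom_X, coeffFun, dif_neg (not_lt.mpr hj), monomial_zero, Finset.sum_const_zero]

/-- **Every input is a specialization up to the generated ideal**: for `|S| ≤ l` and degrees
`≤ d`, the universal family specialized at `S` generates the same ideal as `S`. [folklore] -/
theorem span_univFamily_coeffHom (hS : S.card ≤ l) (hd : ∀ f ∈ S, f.totalDegree ≤ d) :
    Ideal.span (univFamily n d l (coeffHom S) : Set (MvPolynomial (Fin n) k)) =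
      Ideal.span (S : Set (MvPolynomial (Fin n) k)) := by
  classical
  apply le_antisymm
  · rw [Ideal.span_le]
    intro f hf
    rw [univFamily, Finset.coe_image] at hf
    obtain ⟨j, -, rfl⟩ := hf
    by_cases hj : (j : ℕ) < S.card
    · rw [univPoly_coeffHom_of_lt S hd j hj]
      exact Ideal.subset_span (S.equivFin.symm ⟨j, hj⟩).2
    · rw [univPoly_coeffHom_of_le S j (not_lt.mp hj)]
      exact zero_mem _
  · rw [Ideal.span_le]
    intro s hs
    set i : Fin S.card := S.equivFin ⟨s, hs⟩ with hi
    have hil : (i : ℕ) < l := lt_of_lt_of_le i.2 hS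
    have hsj : univPoly n d l (coeffHom S) ⟨i, hil⟩ = s := by
      rw [univPoly_coeffHom_of_lt S hd ⟨i, hil⟩ i.2]
      change ((S.equivFin.symm (S.equivFin ⟨s, hs⟩) : S) : MvPolynomial (Fin n) k) = s
      rw [Equiv.symm_apply_apply]
    rw [← hsj]
    refine Ideal.subset_span ?_
    rw [univFamily, Finset.coe_image]
    exact ⟨⟨i, hil⟩, Finset.mem_univ _, rfl⟩

/-- The only prime number in the kernel of `ℤ[c] → k` is the characteristic of `k`. [folklore] -/
theorem lt_of_prime_mem_ker_coeffHom {p : ℕ} [CharP k p] {M : ℕ} (hMp : M < p) {q : ℕ}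
    (hq : q.Prime) (hqk : (q : CoeffRing n d l) ∈ RingHom.ker (coeffHom S)) : M < q := by
  rw [RingHom.mem_ker, map_natCast, CharP.cast_eq_zero_iff k p] at hqk
  rcases (Nat.dvd_prime hq).mp hqk with h1 | hpq
  · exact absurd h1 (CharP.char_ne_one k p)
  · rw [← hpq]; exact hMp

end Specialize

/-! ## The two inputs and the reduction -/

/-- (C0) **Resolution of the marked ideals `(𝔸ⁿ_K, (S), ∅, 1)` in characteristic zero, from
Kollár's Thm. 3.69** (`Kollar2007MarkedOrderReduction`, `E = ∅`, `m = 1`, on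
`X = 𝔸ⁿ_K = Spec K[x₁, …, xₙ]`, integral, regular, separated of finite type over `K`): for every
field `K` of characteristic zero and every finite `S ⊆ K[x₁, …, xₙ]`, the marked ideal
`(𝔸ⁿ_K, 𝓘_{V(S)}, ∅, 1)` has a resolution in the sense of `MarkedIdeals.lean`. The case
`𝓘_{V(S)} ≠ 0` is the fact itself; for `𝓘_{V(S)} = 0` (BGMW Thm. 4.0.6, first line of the
proof: "If `𝓘 = 0` and `μ > 0` then `supp(X, 𝓘, μ) = X`, and the blow-up of `X` is the empty set
and thus it defines a unique resolution") the blow-up of `𝔸ⁿ` along the zero ideal (the empty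
scheme) resolves `(𝔸ⁿ, 0, ∅, 1)` in one step (`isMarkedResolution_blowup_centre`, the centre
`V(0) = 𝔸ⁿ` being regular with `HasSNCWith [] 0`, `hasSNCWith_nil_of_isRegular`). This statement
(C0) is the characteristic-zero input of `marked_of_charZero_of_spreads` below and of
`bierstoneGrigorievMilmanWlodarczyk2011_of_charZero` (`EffectiveResolutionCharZeroReduction.lean`),
where it is written out as a hypothesis; it is deliberately NOT a named fact of the tree (it is a
special case of `Kollar2007MarkedOrderReduction`, proved from it here).
[cite: Kollar2007, Thm. 3.69 (p. 150)]
[cite: BierstoneGrigorievMilmanWlodarczyk2011, Thm. 4.0.6, proof, first line (p. 11)] -/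
theorem charZeroMarkedResolution_of_kollar (h : Kollar2007MarkedOrderReduction.{0})
    (K : Type) [Field K] [CharZero K] (n : ℕ) (S : Finset (MvPolynomial (Fin n) K)) :
    HasMarkedResolution K n S := by
  have hreg : Scheme.IsRegular (Spec (CommRingCat.of (MvPolynomial (Fin n) K))) :=
    Scheme.isRegular_Spec _
  unfold HasMarkedResolution
  by_cases hker : (affineZeroLocusι K n S).ker = ⊥
  · -- `𝓘 = 0`: blow up the whole space
    obtain ⟨X', π, hπ⟩ := exists_isBlowup (Spec (CommRingCat.of (MvPolynomial (Fin n) K))) ⊥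
    have hC : Scheme.IsRegular (⊥ : (Spec (CommRingCat.of (MvPolynomial (Fin n) K))).IdealSheafData).subscheme :=
      hreg.of_isOpenImmersion (Scheme.IdealSheafData.subschemeι ⊥)
    rw [hker]
    exact ⟨X', π, _, isMarkedResolution_blowup_centre π hπ hC (hasSNCWith_nil_of_isRegular hreg hC)⟩
  · -- `𝓘 ≠ 0`: Kollár's order reduction for `(𝔸ⁿ_K, 𝓘, ∅, 1)`
    have hft : LocallyOfFiniteType (Spec.map (CommRingCat.ofHom
        (algebraMap K (MvPolynomial (Fin n) K)))) := by
      rw [HasRingHomProperty.Spec_iff (P := @LocallyOfFiniteType)]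
      exact RingHom.finiteType_algebraMap.mpr inferInstance
    exact h K (Spec (CommRingCat.of (MvPolynomial (Fin n) K)))
      (Spec.map (CommRingCat.ofHom (algebraMap K (MvPolynomial (Fin n) K)))) inferInstance hft
      inferInstance inferInstance hreg _ hker 1 le_rfl

/-- (SP) **The spreading-out step** for the universal family of `l` polynomials of exponents
`≤ d` in `n` variables (a `Prop`; classical EGA IV₃ §8 / IV₄ §17 technique — spread the
centres of a resolution over the generic point of `V(𝔮) ⊆ Spec ℤ[c]` to smooth families over an
open `D(f) ∩ V(𝔮)` and specialize; NOT a named fact and not yet proved in the tree): for every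
prime `𝔮 ⊆ ℤ[c]` containing no prime number, if the universal instance over the fraction field
of `ℤ[c]/𝔮` has a resolution, then there is `f ∉ 𝔮` such that the instance at every field-valued
point `φ : ℤ[c] → k` with `𝔮 ⊆ ker φ`, `φ(f) ≠ 0` has a resolution. [folklore] -/
def SpreadsFromGenericPoint (n d l : ℕ) : Prop :=
  ∀ (𝔮 : Ideal (CoeffRing n d l)) [𝔮.IsPrime], (∀ p : ℕ, p.Prime → (p : CoeffRing n d l) ∉ 𝔮) →
    HasMarkedResolution (FractionRing (CoeffRing n d l ⧸ 𝔮)) n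
      (univFamily n d l (algebraMap (CoeffRing n d l) (FractionRing (CoeffRing n d l ⧸ 𝔮)))) →
    ∃ f ∉ 𝔮, ∀ (k : Type) [Field k] (φ : CoeffRing n d l →+* k),
      𝔮 ≤ RingHom.ker φ → φ f ≠ 0 → HasMarkedResolution k n (univFamily n d l φ)

/-- The fraction field of `ℤ[c]/𝔮` has characteristic zero when no prime number lies in `𝔮`.
[folklore] -/
theorem charZero_fractionRing_quotient {n d l : ℕ} (𝔮 : Ideal (CoeffRing n d l)) [𝔮.IsPrime]
    (h𝔮 : ∀ p : ℕ, p.Prime → (p : CoeffRing n d l) ∉ 𝔮) :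
    CharZero (FractionRing (CoeffRing n d l ⧸ 𝔮)) := by
  haveI : CharZero (CoeffRing n d l ⧸ 𝔮) := by
    obtain ⟨p, hp⟩ := CharP.exists (CoeffRing n d l ⧸ 𝔮)
    rcases CharP.char_is_prime_or_zero (CoeffRing n d l ⧸ 𝔮) p with hprime | h0
    · refine absurd (Ideal.Quotient.eq_zero_iff_mem.mp ?_) (h𝔮 p hprime)
      rw [map_natCast]
      exact CharP.cast_eq_zero _ p
    · subst h0
      exact CharP.charP_to_charZero _
  exact charZero_of_injective_algebraMap (IsFractionRing.injective (CoeffRing n d l ⧸ 𝔮) _)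

/-- **The large-characteristic marked-resolution statement (BGMW Thm. 8.0.5 existence /
Cor. 8.0.7 for `(𝔸ⁿ_k, (S), ∅, 1)`, the hypothesis of `bierstoneGrigorievMilmanWlodarczyk2011_of_marked`)
from resolution in characteristic zero and the spreading-out step**, with a non-explicit bound
`M(d, n, l)`: Noetherian induction on `Spec ℤ[c]` (`exists_bound_forall_prime_of_generic`), the
goodness of a prime `𝔭` being "every instance at a field-valued point with kernel `𝔭` has a
resolution"; at a prime of residue characteristic zero the universal instance over the fraction
field is resolved by (C0) and spread by (SP); an input `S` over a field `k` of characteristic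
`p > M(d, n, l)` is the specialization at a point whose kernel contains no prime number `≤ M`.
(The perfectness of `k` is not used; the quantifier prefix copies that of
`BierstoneGrigorievMilmanWlodarczyk2011`.)
[cite: BierstoneGrigorievMilmanWlodarczyk2011, Thm. 8.0.5, Cor. 8.0.6–8.0.7] -/
theorem marked_of_charZero_of_spreads
    (h0 : ∀ (K : Type) [Field K] [CharZero K] (n : ℕ) (S : Finset (MvPolynomial (Fin n) K)),
      HasMarkedResolution K n S)
    (hSP : ∀ n d l : ℕ, SpreadsFromGenericPoint n d l) :
    ∃ M : ℕ → ℕ → ℕ → ℕ,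
      ∀ (p : ℕ), p.Prime →
        ∀ (k : Type) [Field k] [CharP k p] [PerfectField k] (n d l : ℕ)
          (S : Finset (MvPolynomial (Fin n) k)),
          S.card ≤ l → (∀ f ∈ S, f.totalDegree ≤ d) → M d n l < p →
            HasMarkedResolution k n S := by
  classical
  -- the good primes of `ℤ[c]`
  let Good : ∀ n d l : ℕ, Ideal (CoeffRing n d l) → Prop := fun n d l 𝔭 =>
    ∀ (k : Type) [Field k] (φ : CoeffRing n d l →+* k), RingHom.ker φ = 𝔭 →
      HasMarkedResolution k n (univFamily n d l φ)
  have hbound : ∀ n d l : ℕ, ∃ M : ℕ, ∀ 𝔭 : Ideal (CoeffRing n d l), 𝔭.IsPrime →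
      (∀ p : ℕ, p.Prime → (p : CoeffRing n d l) ∈ 𝔭 → M < p) → Good n d l 𝔭 := by
    intro n d l
    refine exists_bound_forall_prime_of_generic (Good n d l) fun 𝔮 h𝔮 hchar => ?_
    haveI := h𝔮
    haveI := charZero_fractionRing_quotient 𝔮 hchar
    obtain ⟨f, hf𝔮, hf⟩ := hSP n d l 𝔮 hchar (h0 _ n _)
    exact ⟨f, hf𝔮, fun 𝔭 _ hle hf𝔭 k _ φ hker =>
      hf k φ (hker ▸ hle) (fun h => hf𝔭 (hker ▸ (RingHom.mem_ker).mpr h))⟩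
  choose M hM using hbound
  refine ⟨fun d n l => M n d l, fun p hp k _ _ _ n d l S hS hd hMp => ?_⟩
  -- the input `S` is the specialization at `coeffHom S`, a point of characteristic `p > M`
  have hgood : Good n d l (RingHom.ker (coeffHom (d := d) (l := l) S)) :=
    hM n d l _ (RingHom.ker_isPrime _) fun q hq hqk => lt_of_prime_mem_ker_coeffHom S hMp hq hqk
  have hres : HasMarkedResolution k n (univFamily n d l (coeffHom S)) := hgood k (coeffHom S) rfl
  exact (hasMarkedResolution_congr k n (span_univFamily_coeffHom S hS hd)).mp hres

/-- **The large-characteristic marked-resolution statement from Kollár's Thm. 3.69 and the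
spreading-out step** (composition of `marked_of_charZero_of_spreads` with
`charZeroMarkedResolution_of_kollar`): on this line the hypothesis of
`bierstoneGrigorievMilmanWlodarczyk2011_of_marked` rests on the characteristic-zero named fact
`Kollar2007MarkedOrderReduction` (shared with `Hironaka1964`) and on `SpreadsFromGenericPoint`.
[cite: BierstoneGrigorievMilmanWlodarczyk2011, Thm. 8.0.5, Cor. 8.0.6–8.0.7] -/
theorem marked_of_kollar_of_spreads (h : Kollar2007MarkedOrderReduction.{0})
    (hSP : ∀ n d l : ℕ, SpreadsFromGenericPoint n d l) :
    ∃ M : ℕ → ℕ → ℕ → ℕ,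
      ∀ (p : ℕ), p.Prime →
        ∀ (k : Type) [Field k] [CharP k p] [PerfectField k] (n d l : ℕ)
          (S : Finset (MvPolynomial (Fin n) k)),
          S.card ≤ l → (∀ f ∈ S, f.totalDegree ≤ d) → M d n l < p →
            HasMarkedResolution k n S :=
  marked_of_charZero_of_spreads (charZeroMarkedResolution_of_kollar h) hSP

end Literature.AlgebraicGeometry.Resolution

end
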